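import Mathlib.Analysis.Calculus.Taylor
import Mathlib.Analysis.Distribution.SchwartzSpace.Deriv
import Literature.MathematicalPhysics.QuantumLattice.SchwingerOSAxioms
import Literature.MathematicalPhysics.QuantumLattice.EuclideanAction
import Literature.MathematicalPhysics.QuantumLattice.SchwartzTensor
import Literature.MathematicalPhysics.QuantumLattice.MeshUniformLatticeSums

/-!
# Crux `ContinuumLimitOnTrajectory` (stmt-QuantumFields-10522), line `two-orbit-synchronisation` (seat c2):
# Taylor expansion of a test function along a line, in Schwartz norms (helper of `varBound_of_uuvb`, part B)

Helper file (`--supports stmt-QuantumFields-10522`) of wave-2 worker W2-VAR for the registered stub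
`stub_uclOfGap : UCLOfGap`. The proof of `VarBound` from `UUVB` expands the REFLECTED corner density into plaquette
strings whose electric slots are read one lattice step down in time; on the test-function side this is a translation
by `a_k e₀` in SOME slots only, which does not preserve off-diagonality. The translated test function is therefore
Taylor-expanded along the translation vector: the Taylor coefficients are iterated LINE DERIVATIVES `(∂_v)^[n] f`
(Mathlib's `LineDeriv.lineDerivOp` on the Schwartz space, iterated; supported inside the original support, hence off-diagonal
when the original avoids the coincidence locus) and the remainder is `O(‖v‖^N)` pointwise with Schwartz decay. This file is
the test-function side of that step (sub-namespace `Var`; pure Mathlib + the Schwartz vocabulary of `QuantumLattice`; no new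
definitions):
* `Var.tsupport_iterate_lineDerivOp_subset`, `Var.iteratedDeriv_comp_line` — `(d/dt)^n f(x + t v) = ((∂_v)^[n] f)(x + t v)`;
* `Var.norm_sub_taylor_le` — TAYLOR'S THEOREM along the segment `[x, x + v]`:
  `‖f(x + v) − ∑_{n<N} (n!)⁻¹ ((∂_v)^[n] f)(x)‖ ≤ sup_{t ∈ [0,1]} ‖((∂_v)^[N] f)(x + t v)‖`, and its form `Var.norm_sub_taylorSum_le`
  with the Taylor polynomial `∑_{n<N} (n!)⁻¹ (∂_v)^[n] f` as a test function;
* `Var.seminorm_lineDerivOp_le`, `Var.schwartzNorm_iterate_lineDerivOp_le` — `|(∂_v)^[n] f|_M ≤ ‖v‖^n |f|_{M+n}`;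
* `Var.schwartzNorm_linActMulti_le`, `schwartzNorm_thetaMulti_le`, `schwartzNorm_starTest_le` — the Schwartz norms do not
  increase under the diagonal action of a linear isometry, the time reflection and complex conjugation;
* `Var.norm_sub_taylorSum_le_decay` — for `‖v‖ ≤ 1` the Taylor remainder decays like the Japanese bracket:
  `≤ 4^M |(∂_v)^[N] f|_M (1 + ‖y‖)^{−M}`;
* `Var.sum_box_norm_le_of_decay` — lattice Riemann sums over `(box 4 S)^p` of a function decaying like `K (1 + ‖y‖)^{−8p}`:
  `≤ a^{−4p} (2(a+1))^{4p} K` (tree `sum_piFinset_box_japaneseBracket_le`).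
-/

set_option autoImplicit false

open scoped SchwartzMap ComplexConjugate LineDeriv
open Filter Topology Set
open Literature.MathematicalPhysics.QuantumLattice Literature.Probability.LatticeModels

noncomputable section

namespace Summit.QuantumFields.YangMills.Cruxes.ContinuumLimitOnTrajectory.TwoOrbitSynchronisation

namespace Var

/-! ## Iterated line derivatives and Taylor's theorem along a segment -/

section LineTaylor

variable {X : Type*} [NormedAddCommGroup X] [NormedSpace ℝ X]

/-- The underlying function of `∂_v f` is `y ↦ Df(y) v`. -/
theorem coe_lineDerivOp (v : X) (f : 𝓢(X, ℂ)) :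
    ((∂_{v} f : 𝓢(X, ℂ)) : X → ℂ) = fun y => fderiv ℝ (f : X → ℂ) y v := rfl

/-- Iterated line derivatives do not enlarge the support. -/
theorem tsupport_iterate_lineDerivOp_subset (v : X) (n : ℕ) (f : 𝓢(X, ℂ)) :
    tsupport (((LineDeriv.lineDerivOp v)^[n] f : 𝓢(X, ℂ)) : X → ℂ) ⊆ tsupport (f : X → ℂ) := by
  induction n with
  | zero => exact subset_rfl
  | succ n ih =>
    rw [Function.iterate_succ_apply']
    exact (SchwartzMap.tsupport_lineDerivOp_subset v _).trans ih

/-- The derivative of `t ↦ f(x + t v)` is `(∂_v f)(x + t v)`. -/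
theorem hasDerivAt_comp_line (f : 𝓢(X, ℂ)) (x v : X) (t : ℝ) :
    HasDerivAt (fun s : ℝ => f (x + s • v)) ((∂_{v} f : 𝓢(X, ℂ)) (x + t • v)) t := by
  have h1 : HasDerivAt (fun s : ℝ => x + s • v) v t := by
    simpa using ((hasDerivAt_id t).smul_const v).const_add x
  exact (f.hasFDerivAt (x + t • v)).comp_hasDerivAt t h1

/-- `d/dt f(x + t v) = (∂_v f)(x + t v)`. -/
theorem deriv_comp_line (f : 𝓢(X, ℂ)) (x v : X) :
    deriv (fun s : ℝ => f (x + s • v)) = fun t => (∂_{v} f : 𝓢(X, ℂ)) (x + t • v) :=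
  funext fun t => (hasDerivAt_comp_line f x v t).deriv

/-- **Iterated derivatives along a line are iterated line derivatives**:
`(d/dt)^n f(x + t v) = ((∂_v)^[n] f)(x + t v)`. -/
theorem iteratedDeriv_comp_line (n : ℕ) :
    ∀ (f : 𝓢(X, ℂ)) (x v : X) (t : ℝ),
      iteratedDeriv n (fun s : ℝ => f (x + s • v)) t = ((LineDeriv.lineDerivOp v)^[n] f : 𝓢(X, ℂ)) (x + t • v) := by
  induction n with
  | zero => intro f x v t; simp
  | succ n ih => intro f x v t; rw [iteratedDeriv_succ', deriv_comp_line, ih, Function.iterate_succ_apply]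

/-- `t ↦ f(x + t v)` is smooth. -/
theorem contDiff_comp_line (f : 𝓢(X, ℂ)) (x v : X) (n : ℕ) :
    ContDiff ℝ n (fun s : ℝ => f (x + s • v)) :=
  (f.smooth n).comp (contDiff_const.add (contDiff_id.smul contDiff_const))

/-- **Taylor's theorem along the segment `[x, x + v]`** for a complex test function: if
`‖((∂_v)^[N] f)(x + t v)‖ ≤ C` for `t ∈ [0, 1]`, then `‖f(x + v) − ∑_{n<N} (n!)⁻¹ ((∂_v)^[n] f)(x)‖ ≤ C`. -/
theorem norm_sub_taylor_le (f : 𝓢(X, ℂ)) (x v : X) (N : ℕ) {C : ℝ}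
    (hC : ∀ t ∈ Icc (0 : ℝ) 1, ‖((LineDeriv.lineDerivOp v)^[N] f : 𝓢(X, ℂ)) (x + t • v)‖ ≤ C) :
    ‖f (x + v) - ∑ n ∈ Finset.range N, ((n.factorial : ℝ)⁻¹) • ((LineDeriv.lineDerivOp v)^[n] f : 𝓢(X, ℂ)) x‖ ≤ C := by
  have hC0 : 0 ≤ C := (norm_nonneg _).trans (hC 0 ⟨le_rfl, zero_le_one⟩)
  cases N with
  | zero => simpa using hC 1 ⟨zero_le_one, le_rfl⟩
  | succ n =>
    set φ : ℝ → ℂ := fun s => f (x + s • v) with hφ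
    have hU : UniqueDiffOn ℝ (Icc (0 : ℝ) 1) := uniqueDiffOn_Icc zero_lt_one
    have hder : ∀ k : ℕ, ∀ t ∈ Icc (0 : ℝ) 1, iteratedDerivWithin k φ (Icc 0 1) t =
        ((LineDeriv.lineDerivOp v)^[k] f : 𝓢(X, ℂ)) (x + t • v) := by
      intro k t ht
      rw [iteratedDerivWithin_eq_iteratedDeriv hU (contDiff_comp_line f x v k).contDiffAt ht]
      exact iteratedDeriv_comp_line k f x v t
    have hcd : ContDiffOn ℝ (n + 1) φ (Icc 0 1) := by
      have h := (contDiff_comp_line f x v (n + 1)).contDiffOn (s := Icc 0 1)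
      exact_mod_cast h
    have h := taylor_mean_remainder_bound (f := φ) (a := 0) (b := 1) (x := 1) (n := n) (C := C) zero_le_one hcd
      ⟨zero_le_one, le_rfl⟩ (fun y hy => by rw [hder (n + 1) y hy]; exact hC y hy)
    have htaylor : taylorWithinEval φ n (Icc 0 1) 0 1 =
        ∑ k ∈ Finset.range (n + 1), ((k.factorial : ℝ)⁻¹) • ((LineDeriv.lineDerivOp v)^[k] f : 𝓢(X, ℂ)) x := by
      rw [taylor_within_apply]
      refine Finset.sum_congr rfl fun k _ => ?_
      rw [hder k 0 ⟨le_rfl, zero_le_one⟩, zero_smul, add_zero, sub_zero, one_pow, mul_one]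
    have hφ1 : φ 1 = f (x + v) := by simp [hφ]
    rw [htaylor, hφ1, sub_zero, one_pow, mul_one] at h
    exact h.trans (div_le_self hC0 (by exact_mod_cast Nat.one_le_iff_ne_zero.2 (Nat.factorial_ne_zero n)))

/-- Pointwise values of the Taylor polynomial `∑_{n<N} (n!)⁻¹ (∂_v)^[n] f` (a test function). -/
theorem taylorSum_apply (v : X) (N : ℕ) (f : 𝓢(X, ℂ)) (x : X) :
    (∑ n ∈ Finset.range N, ((n.factorial : ℝ)⁻¹) • ((LineDeriv.lineDerivOp v)^[n] f : 𝓢(X, ℂ))) x =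
      ∑ n ∈ Finset.range N, ((n.factorial : ℝ)⁻¹) • ((LineDeriv.lineDerivOp v)^[n] f : 𝓢(X, ℂ)) x := by
  simp

/-- **The Taylor remainder, pointwise**, with the Taylor polynomial as a test function:
`‖f(x + v) − (∑_{n<N} (n!)⁻¹ (∂_v)^[n] f)(x)‖ ≤ sup_{t∈[0,1]} ‖((∂_v)^[N] f)(x + t v)‖`. -/
theorem norm_sub_taylorSum_le (f : 𝓢(X, ℂ)) (x v : X) (N : ℕ) {C : ℝ}
    (hC : ∀ t ∈ Icc (0 : ℝ) 1, ‖((LineDeriv.lineDerivOp v)^[N] f : 𝓢(X, ℂ)) (x + t • v)‖ ≤ C) :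
    ‖f (x + v) - (∑ n ∈ Finset.range N, ((n.factorial : ℝ)⁻¹) • ((LineDeriv.lineDerivOp v)^[n] f : 𝓢(X, ℂ))) x‖ ≤ C := by
  rw [taylorSum_apply]
  exact norm_sub_taylor_le f x v N hC

/-! ## Schwartz norms of line derivatives -/

/-- `‖∂_v f‖_{k,l} ≤ ‖v‖ ‖f‖_{k,l+1}`. -/
theorem seminorm_lineDerivOp_le (v : X) (f : 𝓢(X, ℂ)) (k l : ℕ) :
    SchwartzMap.seminorm ℂ k l (∂_{v} f : 𝓢(X, ℂ)) ≤ ‖v‖ * SchwartzMap.seminorm ℂ k (l + 1) f := by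
  refine SchwartzMap.seminorm_le_bound ℂ k l _ (by positivity) fun x => ?_
  rw [coe_lineDerivOp]
  have hf : ContDiff ℝ l (fderiv ℝ (f : X → ℂ)) := (f.smooth (l + 1)).fderiv_right (by norm_cast)
  have h1 : ‖iteratedFDeriv ℝ l (fun y => fderiv ℝ (f : X → ℂ) y v) x‖ ≤
      ‖v‖ * ‖iteratedFDeriv ℝ l (fderiv ℝ (f : X → ℂ)) x‖ :=
    norm_iteratedFDeriv_clm_apply_const hf.contDiffAt le_rfl
  rw [norm_iteratedFDeriv_fderiv] at h1
  calc ‖x‖ ^ k * ‖iteratedFDeriv ℝ l (fun y => fderiv ℝ (f : X → ℂ) y v) x‖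
      ≤ ‖x‖ ^ k * (‖v‖ * ‖iteratedFDeriv ℝ (l + 1) (f : X → ℂ) x‖) := by gcongr
    _ = ‖v‖ * (‖x‖ ^ k * ‖iteratedFDeriv ℝ (l + 1) (f : X → ℂ) x‖) := by ring
    _ ≤ ‖v‖ * SchwartzMap.seminorm ℂ k (l + 1) f := by gcongr; exact SchwartzMap.le_seminorm ℂ k (l + 1) f x

/-- `|∂_v f|_M ≤ ‖v‖ |f|_{M+1}`. -/
theorem schwartzNorm_lineDerivOp_le (v : X) (f : 𝓢(X, ℂ)) (M : ℕ) :
    schwartzNorm M (∂_{v} f : 𝓢(X, ℂ)) ≤ ‖v‖ * schwartzNorm (M + 1) f := by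
  unfold schwartzNorm
  refine Seminorm.finset_sup_apply_le (mul_nonneg (norm_nonneg _) (apply_nonneg _ _)) fun i hi => ?_
  obtain ⟨hk, hl⟩ := Prod.mk_le_mk.1 (Finset.mem_Iic.1 hi)
  rw [SchwartzMap.schwartzSeminormFamily_apply]
  exact (seminorm_lineDerivOp_le v f i.1 i.2).trans
    (mul_le_mul_of_nonneg_left (seminorm_le_schwartzNorm (by omega) (by omega) f) (norm_nonneg _))

/-- **`|(∂_v)^[n] f|_M ≤ ‖v‖^n |f|_{M+n}`.** -/
theorem schwartzNorm_iterate_lineDerivOp_le (v : X) (f : 𝓢(X, ℂ)) (n : ℕ) :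
    ∀ M : ℕ, schwartzNorm M ((LineDeriv.lineDerivOp v)^[n] f : 𝓢(X, ℂ)) ≤ ‖v‖ ^ n * schwartzNorm (M + n) f := by
  induction n with
  | zero => intro M; simp
  | succ n ih =>
    intro M
    rw [Function.iterate_succ_apply']
    calc schwartzNorm M (∂_{v} ((LineDeriv.lineDerivOp v)^[n] f) : 𝓢(X, ℂ))
        ≤ ‖v‖ * schwartzNorm (M + 1) ((LineDeriv.lineDerivOp v)^[n] f : 𝓢(X, ℂ)) := schwartzNorm_lineDerivOp_le _ _ _
      _ ≤ ‖v‖ * (‖v‖ ^ n * schwartzNorm (M + 1 + n) f) := mul_le_mul_of_nonneg_left (ih (M + 1)) (norm_nonneg _)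
      _ = ‖v‖ ^ (n + 1) * schwartzNorm (M + (n + 1)) f := by
          rw [pow_succ, show M + 1 + n = M + (n + 1) by omega]; ring

/-! ## Isometries and conjugation do not increase Schwartz norms -/

/-- `‖conj f‖_{k,l} ≤ ‖f‖_{k,l}`. -/
theorem seminorm_starTest_le (f : 𝓢(X, ℂ)) (k l : ℕ) :
    SchwartzMap.seminorm ℂ k l (starTest f) ≤ SchwartzMap.seminorm ℂ k l f := by
  refine SchwartzMap.seminorm_le_bound ℂ k l _ (apply_nonneg _ _) fun x => ?_
  have hcoe : ((starTest f : 𝓢(X, ℂ)) : X → ℂ) = Complex.conjLIE ∘ (f : X → ℂ) := by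
    funext y; simp [starTest_apply]
  rw [hcoe, Complex.conjLIE.norm_iteratedFDeriv_comp_left]
  exact SchwartzMap.le_seminorm ℂ k l f x

/-- `|conj f|_M ≤ |f|_M`. -/
theorem schwartzNorm_starTest_le (f : 𝓢(X, ℂ)) (M : ℕ) : schwartzNorm M (starTest f) ≤ schwartzNorm M f := by
  unfold schwartzNorm
  refine Seminorm.finset_sup_apply_le (apply_nonneg _ _) fun i hi => ?_
  obtain ⟨hk, hl⟩ := Prod.mk_le_mk.1 (Finset.mem_Iic.1 hi)
  rw [SchwartzMap.schwartzSeminormFamily_apply]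
  exact (seminorm_starTest_le f i.1 i.2).trans (seminorm_le_schwartzNorm hk hl f)

end LineTaylor

section Isometry

variable {E : Type*} [NormedAddCommGroup E] [NormedSpace ℝ E] {n : ℕ}

/-- `‖F ∘ R‖_{k,l} ≤ ‖F‖_{k,l}` for the diagonal action of a linear isometry `R` (the diagonal action is a linear isometry of
`Fin n → E` with its sup norm). -/
theorem seminorm_linActMulti_le (L : E ≃ₗᵢ[ℝ] E) (F : 𝓢((Fin n → E), ℂ)) (k l : ℕ) :
    SchwartzMap.seminorm ℂ k l (linActMulti L F) ≤ SchwartzMap.seminorm ℂ k l F := by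
  -- the diagonal action of `L⁻¹` as a linear isometry of `Fin n → E`
  let gI : (Fin n → E) ≃ₗᵢ[ℝ] (Fin n → E) :=
    { toLinearEquiv := LinearEquiv.piCongrRight fun _ : Fin n => L.symm.toLinearEquiv
      norm_map' := fun x => by
        change ‖fun i => L.symm (x i)‖ = ‖x‖
        refine le_antisymm ((pi_norm_le_iff_of_nonneg (norm_nonneg _)).2 fun i => ?_)
          ((pi_norm_le_iff_of_nonneg (norm_nonneg _)).2 fun i => ?_)
        · rw [L.symm.norm_map]; exact norm_le_pi_norm x i
        · have h := norm_le_pi_norm (fun i => L.symm (x i)) i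
          rwa [L.symm.norm_map] at h }
  refine SchwartzMap.seminorm_le_bound ℂ k l _ (apply_nonneg _ _) fun x => ?_
  have key := gI.norm_iteratedFDeriv_comp_right (F : (Fin n → E) → ℂ) x l
  have hcoe : ((linActMulti L F : 𝓢((Fin n → E), ℂ)) : (Fin n → E) → ℂ) = (F : (Fin n → E) → ℂ) ∘ gI := by
    funext y; rfl
  have h1 : ‖iteratedFDeriv ℝ l ((linActMulti L F : 𝓢((Fin n → E), ℂ)) : (Fin n → E) → ℂ) x‖ =
      ‖iteratedFDeriv ℝ l (F : (Fin n → E) → ℂ) (gI x)‖ := by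
    rw [hcoe]; exact key
  rw [h1, ← gI.norm_map x]
  exact SchwartzMap.le_seminorm ℂ k l F _

/-- **`|R F|_M ≤ |F|_M`** for the diagonal action of a linear isometry. -/
theorem schwartzNorm_linActMulti_le (L : E ≃ₗᵢ[ℝ] E) (F : 𝓢((Fin n → E), ℂ)) (M : ℕ) :
    schwartzNorm M (linActMulti L F) ≤ schwartzNorm M F := by
  unfold schwartzNorm
  refine Seminorm.finset_sup_apply_le (apply_nonneg _ _) fun i hi => ?_
  obtain ⟨hk, hl⟩ := Prod.mk_le_mk.1 (Finset.mem_Iic.1 hi)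
  rw [SchwartzMap.schwartzSeminormFamily_apply]
  exact (seminorm_linActMulti_le L F i.1 i.2).trans (seminorm_le_schwartzNorm hk hl F)

/-- `|θF|_M ≤ |F|_M` for the diagonal time reflection. -/
theorem schwartzNorm_thetaMulti_le {d : ℕ} [NeZero d] (F : 𝓢((Fin n → EuclideanSpace ℝ (Fin d)), ℂ)) (M : ℕ) :
    schwartzNorm M (thetaMulti d F) ≤ schwartzNorm M F :=
  schwartzNorm_linActMulti_le (timeReflection d) F M

/-- `|conj θF|_M ≤ |F|_M`. -/
theorem schwartzNorm_starTest_thetaMulti_le {d : ℕ} [NeZero d] (F : 𝓢((Fin n → EuclideanSpace ℝ (Fin d)), ℂ))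
    (M : ℕ) : schwartzNorm M (starTest (thetaMulti d F)) ≤ schwartzNorm M F :=
  (schwartzNorm_starTest_le _ M).trans (schwartzNorm_thetaMulti_le F M)

end Isometry

/-! ## Decay of the Taylor remainder and lattice Riemann sums -/

section Decay

variable {X : Type*} [NormedAddCommGroup X] [NormedSpace ℝ X]

/-- Pointwise Schwartz decay in the tree's currency (as in …UclSums): `‖f y‖ ≤ 2^M |f|_M (1 + ‖y‖)^{-M}`. -/
theorem norm_apply_le_schwartzNorm_mul_inv (M : ℕ) (f : 𝓢(X, ℂ)) (y : X) :
    ‖f y‖ ≤ 2 ^ M * schwartzNorm M f * ((1 + ‖y‖) ^ M)⁻¹ := by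
  have h := SchwartzMap.one_add_le_sup_seminorm_apply (𝕜 := ℂ) (m := (M, M)) (k := M) (n := 0) le_rfl (Nat.zero_le _) f y
  rw [norm_iteratedFDeriv_zero] at h
  have hpos : 0 < (1 + ‖y‖) ^ M := by positivity
  rw [le_mul_inv_iff₀ hpos]
  calc ‖f y‖ * (1 + ‖y‖) ^ M = (1 + ‖y‖) ^ M * ‖f y‖ := mul_comm _ _
    _ ≤ 2 ^ M * (Finset.Iic (M, M)).sup (fun m => SchwartzMap.seminorm ℂ m.1 m.2) f := h
    _ = 2 ^ M * schwartzNorm M f := rfl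

/-- **Decay of the Taylor remainder**: for `‖v‖ ≤ 1`,
`‖f(y + v) − (∑_{n<N} (n!)⁻¹ (∂_v)^[n] f)(y)‖ ≤ 4^M |(∂_v)^[N] f|_M (1 + ‖y‖)^{−M}` (the segment `[y, y + v]` stays within unit
distance of `y`, where the Japanese bracket changes by a factor `≤ 2`). -/
theorem norm_sub_taylorSum_le_decay (f : 𝓢(X, ℂ)) (y v : X) (hv : ‖v‖ ≤ 1) (N M : ℕ) :
    ‖f (y + v) - (∑ n ∈ Finset.range N, ((n.factorial : ℝ)⁻¹) • ((LineDeriv.lineDerivOp v)^[n] f : 𝓢(X, ℂ))) y‖ ≤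
      4 ^ M * schwartzNorm M ((LineDeriv.lineDerivOp v)^[N] f : 𝓢(X, ℂ)) * ((1 + ‖y‖) ^ M)⁻¹ := by
  refine norm_sub_taylorSum_le f y v N fun t ht => ?_
  set g : 𝓢(X, ℂ) := (LineDeriv.lineDerivOp v)^[N] f with hg
  have hdec := norm_apply_le_schwartzNorm_mul_inv M g (y + t • v)
  have ht1 : ‖t • v‖ ≤ 1 := by
    rw [norm_smul, Real.norm_of_nonneg ht.1]
    exact mul_le_one₀ ht.2 (norm_nonneg _) hv
  have h1 : 1 + ‖y‖ ≤ 2 * (1 + ‖y + t • v‖) := by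
    have h2 : ‖y‖ ≤ ‖y + t • v‖ + ‖t • v‖ := by
      have := norm_add_le (y + t • v) (-(t • v))
      rwa [add_neg_cancel_right, norm_neg] at this
    linarith [norm_nonneg (y + t • v)]
  have hposy : 0 < (1 + ‖y‖) ^ M := by positivity
  have hpos : 0 < (1 + ‖y + t • v‖) ^ M := by positivity
  have h3 : ((1 + ‖y + t • v‖) ^ M)⁻¹ ≤ 2 ^ M * ((1 + ‖y‖) ^ M)⁻¹ := by
    rw [inv_le_iff_one_le_mul₀ hpos, mul_assoc, mul_comm (((1 + ‖y‖) ^ M)⁻¹), ← div_eq_mul_inv,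
      mul_div_assoc', le_div_iff₀ hposy, one_mul, ← mul_pow]
    exact pow_le_pow_left₀ (by positivity) (by linarith) M
  have hS := schwartzNorm_nonneg M g
  calc ‖g (y + t • v)‖ ≤ 2 ^ M * schwartzNorm M g * ((1 + ‖y + t • v‖) ^ M)⁻¹ := hdec
    _ ≤ 2 ^ M * schwartzNorm M g * (2 ^ M * ((1 + ‖y‖) ^ M)⁻¹) := mul_le_mul_of_nonneg_left h3 (by positivity)
    _ = 4 ^ M * schwartzNorm M g * ((1 + ‖y‖) ^ M)⁻¹ := by
        rw [show (4 : ℝ) ^ M = 2 ^ M * 2 ^ M by rw [← mul_pow]; norm_num]; ring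

end Decay

section LatticeSum

/-- **Lattice Riemann sum of a decaying function over the box** (the form of …UclSums' `sum_norm_apply_smul_siteToE_le`
for an arbitrary function with Japanese-bracket decay of order `8p`): for `0 < a`,
`∑_{x : Fin p → box 4 S} ‖g(a x⃗)‖ ≤ a^{−4p} (2(a+1))^{4p} K`. -/
theorem sum_box_norm_le_of_decay {p : ℕ} {a : ℝ} (ha : 0 < a) (S : ℕ)
    (g : (Fin p → EuclideanSpace ℝ (Fin 4)) → ℂ) {K : ℝ} (hK : 0 ≤ K)
    (hg : ∀ y, ‖g y‖ ≤ K * ((1 + ‖y‖) ^ (8 * p))⁻¹) :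
    ∑ x : Fin p → ↥(box 4 S), ‖g (fun i => a • siteToE (↑(x i) : Site 4))‖ ≤
      (a ^ (4 * p))⁻¹ * (2 * (a + 1)) ^ (4 * p) * K := by
  -- adapted from …UclSums (`sum_norm_apply_smul_siteToE_le`)
  have hsum : ∑ x : Fin p → ↥(box 4 S), ‖g (fun i => a • siteToE (↑(x i) : Site 4))‖ =
      ∑ x ∈ Fintype.piFinset (fun _ : Fin p => box 4 S), ‖g (fun i => a • siteToE (x i))‖ := by
    rw [← Finset.sum_coe_sort (Fintype.piFinset fun _ : Fin p => box 4 S)]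
    refine Fintype.sum_equiv ((Equiv.subtypePiEquivPi (p := fun _ : Fin p => fun y : Site 4 => y ∈ box 4 S)).symm.trans
      (Equiv.subtypeEquivRight fun f => by simp [Fintype.mem_piFinset])) _ _ fun x => rfl
  rw [hsum]
  have hjb := sum_piFinset_box_japaneseBracket_le a ha.le 4 p S
  have hap : 0 < a ^ (4 * p) := pow_pos ha _
  calc ∑ x ∈ Fintype.piFinset (fun _ : Fin p => box 4 S), ‖g (fun i => a • siteToE (x i))‖
      ≤ ∑ x ∈ Fintype.piFinset (fun _ : Fin p => box 4 S), K * ((1 + ‖fun i => a • siteToE (x i)‖) ^ (8 * p))⁻¹ :=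
        Finset.sum_le_sum fun x _ => hg _
    _ = (a ^ (4 * p))⁻¹ * K * ∑ x ∈ Fintype.piFinset (fun _ : Fin p => box 4 S),
          a ^ (4 * p) / (1 + ‖fun i => a • siteToE (x i)‖) ^ (2 * (4 * p)) := by
        rw [Finset.mul_sum]
        refine Finset.sum_congr rfl fun x _ => ?_
        have : 2 * (4 * p) = 8 * p := by ring
        rw [this, div_eq_mul_inv]
        field_simp
    _ ≤ (a ^ (4 * p))⁻¹ * K * (2 * (a + 1)) ^ (4 * p) :=
        mul_le_mul_of_nonneg_left hjb (mul_nonneg (inv_nonneg.2 hap.le) hK)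
    _ = (a ^ (4 * p))⁻¹ * (2 * (a + 1)) ^ (4 * p) * K := by ring

end LatticeSum

end Var

/-- **Registered anchor of this file** (closed form of `Var.schwartzNorm_iterate_lineDerivOp_le`, for the gate's `--supports` stub
check): the Schwartz norms of the iterated line derivatives of a test function grow at most like `‖v‖^n`, at the cost of `n`
orders. -/
theorem varB_schwartzNorm_dL_le :
    ∀ {X : Type} [NormedAddCommGroup X] [NormedSpace ℝ X] (v : X) (f : 𝓢(X, ℂ)) (n M : ℕ),
      schwartzNorm M ((LineDeriv.lineDerivOp v)^[n] f) ≤ ‖v‖ ^ n * schwartzNorm (M + n) f := by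
  intro X _ _ v f n M
  exact Var.schwartzNorm_iterate_lineDerivOp_le v f n M

end Summit.QuantumFields.YangMills.Cruxes.ContinuumLimitOnTrajectory.TwoOrbitSynchronisation

end
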